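import Summits.RiemannHypothesis.RiemannHypothesis.Theses.WeilAutocorrelation
import HarnessLib

/-!
# `WeilAutocorrelation.Assembly` (item stmt-RiemannHypothesis-19994) — glue closer

The assembly item of route `WeilAutocorrelation` is, literally, the type of the route's deciding theorem
`Theses.WeilAutocorrelation.closes` (which takes exactly the route's other items as hypotheses and no `Assembly`
binder), so the deciding theorem itself is the proof.
Cell rh-split (typer-3 g3 glue sweep, RULING #374).  Pure propositional glue; no analysis.
Nothing here bears on the truth of RH.
-/

set_option linter.dupNamespace false  -- the mandated namespace repeats `RiemannHypothesis`

namespace Summit.RiemannHypothesis.RiemannHypothesis.Theorems.WeilAutocorrelation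

/-- **`Assembly` (item stmt-RiemannHypothesis-19994) holds**: it is the type of the route's deciding
theorem `Theses.WeilAutocorrelation.closes`. [folklore] -/
theorem assembly_proof : Summit.RiemannHypothesis.RiemannHypothesis.Theses.WeilAutocorrelation.Assembly :=
  Summit.RiemannHypothesis.RiemannHypothesis.Theses.WeilAutocorrelation.closes

end Summit.RiemannHypothesis.RiemannHypothesis.Theorems.WeilAutocorrelation
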